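import Summits.QuantumFields.YangMills.Theorems.BalabanUVNodesN18HLayerW1TermInputs226
import Summits.QuantumFields.YangMills.Theorems.BalabanUVNodesN18HLayerW1TermWalkRecord

/-!
# BalabanUVNodes ∕ N18 — NODE A's WALK RECORD `TermWalkData` INSTANCES node00-def-W1's RECORD OF LOCATED (2.26) INPUTS `TermDatum214.Inputs226Holo`
# ALONG THE CONFIGURATION, with the letters exhibited (Track A, DAG node N18 = NE5 `T4OutputRate.NE5 EA EB W κ θ C₅` :211; cluster K4 «SpineRates»;
# file 31 of seat pub-ymgap-dag-n18-c, row s1 «the H-layer activity datum on the record's torus catalogue: instance + estimate», generation 10)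

Cell `pub-ymgap`, HUMAN RULING D-0062 (Track A), R134 ACCELERATION seat `pub-ymgap-dag-n18-c` (strategy s1), generation 10.  THEOREMS ONLY (no `def`, no
`instance`, no `sorry`); imports file 30 `…N18HLayerW1TermInputs226` (the configuration-direction socket keyed on W1's STOREY 8 record) and file 27
`…N18HLayerW1TermWalkRecord` (through it NODE A's `B13TermWalkData`, the (J1) glue `TwoRunTorusWalkH226.sigma_region_glue`, W1's STOREY 7) BY NAME.

WHY.  W1's STOREY 8 (`Node00/HistoryTermDatum214Inputs226` §3) says who inhabits its record: «holders of the two named (2.16)-level records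
`Localisation17a ∕ Differences216` — NODE A's capstones `localisation17a_of_termWalkData ∕ differences216_of_termWalkData` at `u := 𝔇.uOf Z t φ` — fill the
seven letter fields by the projections».  Nobody had typed that inhabitant.  THIS FILE does, for a datum at `c⁺ := {c with κ₁ := κ₁ + 1}` (the (J1) glue of
T25 ∕ file 27: walk road at `c⁺`, σ-region `ball 0 e^{κ₁+1}` between the two closed polydiscs) and the estimate's record `c`: from ONE walk record
`TermWalkData (𝔇.𝒦 Z t) w` of the term's kernels with ONE admissible small package `w` (`w.Admissible α Rσ₀`, `SmallTheta w α θ`), the configuration read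
inside the `α`-ball (`𝔇.uOf Z t φ ∈ ball 0 α`), NODE O's σ-holomorphy and NODE A's symmetry ∕ `Re ≻ 0` at that configuration, LEMMA 2's potentials
(measurable, (2.20)), (2.22), the fibre bound and the numerics of (2.24)–(2.26) in the record's letters, the record `𝔇.Inputs226Holo c Z t s old φ a a₅` IS
INHABITED, with its letters EXHIBITED: `Uσ = ball 0 e^{κ₁+1}`, `κ = κ_b` (two drops below the record's torus rate `w.κ`), `K_G = K_Γ = K̄_Γ`,
`K_Cs = K₀ = K̄_C`, `θ_Γ = 2K̄_Γ(e^{−εR_σ} + α∕R)`, `θ_E = 2K̄_E(e^{−εR_σ} + α∕R)`, `θ_C = K̄_C·θ_E·(m(1+2∕(κ−κ_a)))^ν·K̄_C·(m(1+2∕(κ_a−κ_b)))^ν`.  On an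
open table `V` read into the `α`-ball by a holomorphic reading map the SAME letters serve every point, so file 30's table-based hypothesis holds and the
three nodes' record-keyed sockets (N10 `B13TermDatum214ParamHolo`, N22 (S-226-T′), N18 file 30) are fed by NODE A's typed deliverable through ONE door.

WHAT (theorems only).
* §1 ONE CONFIGURATION: ★ `exists_inputs226Holo_of_termWalkData` (the record at `φ`, with the ten letters the configuration-dependent fields mention
  exhibited as equations), `primitiveInputs226Holo_of_termWalkData` (W1's Prop shadow — the first typed producer of STOREY 8's record from NODE A's
  `TermWalkData`; whence (2.26) at `φ` by W1's `norm_TF_le_weight_of_inputs226Holo`).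
* §2 AN OPEN TABLE `V` with `uOf` holomorphic on `V` into `ball 0 α`: ★★ `inputs226Holo_on_of_termWalkData` — file 30's table-based hypothesis (at every
  `φ₁ ∈ V` a record whose eleven configuration-dependent fields hold on all of `V` + the three joint-holomorphy letters, the latter by NODE A's joint walk
  expansions `JointWalkExpansion.analyticOnBall` ∘ the reading map), ★★ `analyticOnNhd_and_primitiveInputs226Holo_of_termWalkData` — file 30 applied:
  (T-an) on `V` AND W1's record at every point of `V`, from ONE walk record.

HONEST FRAMING — what this is NOT.  Count-neutral bookkeeping: a record of HYPOTHESES is inhabited FROM HYPOTHESES (the walk record, the reading map,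
NODE O's σ-holomorphy, NODE A's symmetry ∕ `Re ≻ 0`, LEMMA 2, (2.22), the numerics) by landed projections; NO estimate of Bałaban's is proved here; no walk
record is constructed (NODE A's (v) `ExistsWalkDataUniform[Small]` is NODE A's, instance 0∕1).  NOT a discharge of N18 (typed 28∕28 · discharged 5∕27
UNCHANGED); NE5 NOT IN PRINT ([I] Thm 1 p. 259) and NOT PROVED.  One finite four-torus programme at fixed `ε`, Bałaban as printed — NOT ℝ⁴, NOT infinite
volume, NOT OS, NOT a mass gap, NOT Clay.  0 `sorry`, 0 `def`.

References (TYPES ∕ loci only): [II] = [Balaban1988RG2Cluster] CMP **116** (1988) — p. 5 (κ₁), (1.41) p. 11, p. 13, (2.14)–(2.16) pp. 15–16 and the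
analyticity statement p. 15, (2.18)–(2.26) pp. 16–17; [I] = [Balaban1987RG1] CMP **109** (1987) — Thm 1 p. 259; [B9] = [Balaban1985BackgroundPropagators]
CMP **99** (1985) Thm 3.10 p. 416; [Chae1985] Thm 14.13.
-/

noncomputable section

open scoped Classical

namespace Summit.QuantumFields.YangMills.BalabanUVNodes.N18HLayerW1TermWalkRecordInputs226

open Set Metric
open scoped BigOperators Matrix Matrix.Norms.L2Operator
open Literature.MathematicalPhysics.QuantumFieldTheory.Balaban1983to89
open Literature.MathematicalPhysics.QuantumFieldTheory.Balaban1983to89.TreeLengthTorus (TDom TPt tsys)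
open Literature.MathematicalPhysics.QuantumFieldTheory.Balaban1983to89.B13Lemma3TorusTerms (weight)
open Literature.MathematicalPhysics.QuantumFieldTheory.Balaban1983to89.B13Bound143 (invTau)
open Literature.MathematicalPhysics.QuantumFieldTheory.Balaban1983to89.B9Thm37GlueTorus (tdist1)
open Literature.MathematicalPhysics.QuantumFieldTheory.Balaban1983to89.B5TorusCover (UT)
open Literature.MathematicalPhysics.QuantumFieldTheory.Balaban1983to89.B13PrimitiveKernels216
  (Localisation17a Differences216 localisation17a_mono_rate)
open Literature.MathematicalPhysics.QuantumFieldTheory.Balaban1983to89.B13TermWalkData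
  (WalkConsts TermWalkData localisation17a_of_termWalkData differences216_of_termWalkData)
open Literature.MathematicalPhysics.QuantumFieldTheory.Balaban1983to89.B13TermWalkDataOneTorus (SmallTheta)
open Literature.MathematicalPhysics.QuantumFieldTheory.Balaban1983to89.Node00
open Literature.MathematicalPhysics.QuantumFieldTheory.Balaban1983to89.Node00.Sect2 (domSys domCount CPair)
open Literature.MathematicalPhysics.QuantumFieldTheory.Balaban1983to89.Node00.W1
open Summit.QuantumFields.BalabanUV.T4Continuum.Spine.NE5.TwoRunTorusWalkH226 (sigma_region_glue)
open Summit.QuantumFields.YangMills.BalabanUVNodes.N18HLayerW1TermInputs226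
  (differentiableOn_and_norm_TF_of_inputs226Holo_on analyticOnNhd_and_primitiveInputs226Holo_of_inputs226Holo_on)

variable {c : B13.Consts} {P : Params} {𝔸 : Type} [NormedRing 𝔸] [NormedAlgebra ℂ 𝔸] {M k L : ℕ} [NeZero L]
  (𝔇 : TermDatum214 ({ c with κ₁ := c.κ₁ + 1 } : B13.Consts) P 𝔸 M k L)

/-! ## §1 One configuration inside the `α`-ball: the record is inhabited, letters exhibited -/

section Point

variable (Z : (domSys P M (k + 1)).Dom) (t : TermLabel P M k L) (s : ℂ) (old : OlderTerms P 𝔸 M k)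
    (hpos : ∀ Y : TDom P.d (L * domCount P M (k + 1)), 0 < invTau c ((tsys P.d (L * domCount P M (k + 1))).dj Y))
    (hhalf : ∀ Y : TDom P.d (L * domCount P M (k + 1)), invTau c ((tsys P.d (L * domCount P M (k + 1))).dj Y) ≤ 1 / 2)
    -- the PER-DOMAIN τ-regions (print's radii (2.18)) and the contour radius of the datum; the σ-region is `ball 0 e^{κ₁+1}` (the (J1) glue)
    {Uτ : TDom P.d (L * domCount P M (k + 1)) → Set ℂ} (hUτ : ∀ Y, IsOpen (Uτ Y))
    (hUtau : ∀ Y : TDom P.d (L * domCount P M (k + 1)),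
      closedBall (0 : ℂ) ((invTau c ((tsys P.d (L * domCount P M (k + 1))).dj Y))⁻¹) ⊆ Uτ Y)
    (hr : 0 < 𝔇.r) (hr' : 𝔇.r ≤ Real.exp c.κ₁ - 1)
    (hsubτ : ∀ Y, ∀ x ∈ Set.uIcc (0 : ℝ) 1, closedBall (x : ℂ) 𝔇.r ⊆ Uτ Y)
    -- NODE A's WALK RECORD of the term's kernels at `c⁺`, ONE admissible small package; ONE configuration read inside the `α`-ball ([II] p. 15)
    {w : WalkConsts} {α Rσ₀ : ℝ} (hw : w.Admissible α Rσ₀) (hα : 0 < α) (h𝒦 : TermWalkData (𝔇.𝒦 Z t) w)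
    {φ : CPair P 𝔸} (hu : 𝔇.uOf Z t φ ∈ ball (0 : 𝔇.E₃) α)
    -- the last line at the coupling: signs and measurability of χ, χᶜ
    (hχ0 : ∀ B, 0 ≤ 𝔇.chiY₀ Z t s B) (hχc0 : ∀ B, 0 ≤ 𝔇.chicP Z t s B)
    (hχm : Measurable (𝔇.chiY₀ Z t s)) (hχcm : Measurable (𝔇.chicP Z t s))
    -- NOT walk data: σ-holomorphy of the kernels on the open `e^{κ₁+1}`-polydisc (NODE O), symmetry ∕ `Re ≻ 0` on the closed `c⁺`-polydisc (NODE A), at `φ`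
    (hAhol : ∀ i j, DifferentiableOn ℂ (fun σ => 𝔇.A Z t φ σ i j) {σ | ∀ j, σ j ∈ ball (0 : ℂ) (Real.exp (c.κ₁ + 1))})
    (hGhol : ∀ i j, DifferentiableOn ℂ (fun σ => (𝔇.𝒦 Z t).G2 σ (𝔇.uOf Z t φ) i j) {σ | ∀ j, σ j ∈ ball (0 : ℂ) (Real.exp (c.κ₁ + 1))})
    (hAs : ∀ σ : TPt P.d (domCount P M (k + 1)) → ℂ, (∀ j, ‖σ j‖ ≤ Real.exp (c.κ₁ + 1)) → (𝔇.A Z t φ σ).IsSymm)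
    (hA : ∀ σ : TPt P.d (domCount P M (k + 1)) → ℂ, (∀ j, ‖σ j‖ ≤ Real.exp (c.κ₁ + 1)) → ((𝔇.A Z t φ σ).map Complex.re).PosDef)
    -- LEMMA 2 at (coupling, history, configuration): the potentials measurable in the row-bond field, (2.20) on `Π_Y Uτ Y`
    (hVm : ∀ Y, Measurable (𝔇.𝒱 Z t s old φ Y))
    {γ₂ rP a₂₀ w₂₀ : ℝ} (qP : ((𝔇.𝒦 Z t).Λ → ℝ) → ℝ)
    (h222 : ∀ B, 𝔇.chiY₀ Z t s B * 𝔇.chicP Z t s B ≤ Real.exp (-(γ₂ / 2 * rP ^ 2 * (t.2.card : ℕ)) + γ₂ / 2 * qP B)) (hγ₂ : 0 ≤ γ₂)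
    (hqP : ∀ B, qP B ≤ B ⬝ᵥ B) (ha0 : 0 ≤ a₂₀)
    (h220U : ∀ τ : TDom P.d (L * domCount P M (k + 1)) → ℂ, (∀ Y, τ Y ∈ Uτ Y) →
      ∀ B, ∑ Y ∈ t.1, ‖τ Y‖ * ‖𝔇.𝒱 Z t s old φ Y B‖ ≤ a₂₀ / 2 * (B ⬝ᵥ B) + w₂₀)
    -- the column fibre bound by the record's own `m` (rows: the record's `hfib`)
    (hfibN : ∀ x : UT 𝔇.Nf, (Finset.univ.filter fun j => (𝔇.𝒦 Z t).locN j = x).card ≤ (𝔇.𝒦 Z t).m)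
    -- rates: the record's torus rate `w.κ`, two drops for (L16a), two more for the (2.26) chain
    {κa κb kap' kap'' θ : ℝ} (hκa : κa < w.kap) (hκb : κb < κa) (h2 : kap' < κb) (h1 : kap'' < kap') (hkap'' : 0 < kap'')
    -- NODE A's smallness BY NAME: `θ_Γ, θ_E ≤ θ` with `θ_• = 2K̄_•(e^{−εR_σ} + α∕R)`
    (hsm : SmallTheta w α θ)
    (hθR1le : ((𝔇.𝒦 Z t).m * (1 + 2 / (κb - kap')) ^ 𝔇.ν) * ((𝔇.𝒦 Z t).m * (1 + 2 / (kap' - kap'')) ^ 𝔇.ν)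
      * ((2 * w.KbarΓ * Real.exp (-(w.ε * w.Rσ)) + 2 * w.KbarΓ * α / w.R) * w.KbarC * w.KbarΓ
        + w.KbarΓ * (w.KbarC * (2 * w.KbarE * Real.exp (-(w.ε * w.Rσ)) + 2 * w.KbarE * α / w.R)
            * ((𝔇.𝒦 Z t).m * (1 + 2 / (w.kap - κa)) ^ 𝔇.ν) * w.KbarC * ((𝔇.𝒦 Z t).m * (1 + 2 / (κa - κb)) ^ 𝔇.ν)) * w.KbarΓ
        + w.KbarΓ * w.KbarC * (2 * w.KbarΓ * Real.exp (-(w.ε * w.Rσ)) + 2 * w.KbarΓ * α / w.R)) ≤ θ)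
    (hsmallKθ : w.KbarC * ((𝔇.𝒦 Z t).m * (1 + 2 / κb) ^ 𝔇.ν) * (θ * ((𝔇.𝒦 Z t).m * (1 + 2 / kap'') ^ 𝔇.ν)) < 1)
    {cE g : ℝ} (hc0 : 0 ≤ cE) (hc : ∀ i, (𝔇.𝒦 Z t).hC.1.eigenvalues i ≤ cE)
    (hαc : (2 * (θ * ((𝔇.𝒦 Z t).m * (1 + 2 / kap'') ^ 𝔇.ν)) + (γ₂ + a₂₀)) * cE ≤ 1 / 2) (hg : 0 ≤ g)
    (hΓq : ∀ X : (𝔇.𝒦 Z t).Λ ⊕ (𝔇.𝒦 Z t).C₀ → ℝ,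
      ((𝔇.𝒦 Z t).Γ₀ *ᵥ X) ⬝ᵥ ((𝔇.𝒦 Z t).C *ᵥ ((𝔇.𝒦 Z t).Γ₀ *ᵥ X)) ≤ g * (X ⬝ᵥ X))
    (hsmall : (2 * (θ * ((𝔇.𝒦 Z t).m * (1 + 2 / kap'') ^ 𝔇.ν)) + (γ₂ + a₂₀)) * (1 + 2 * cE * g) ≤ 1 / 2)
    {a a₅ : ℝ} (hPa : a ≤ γ₂ * rP ^ 2)
    (hvol : 2 * (w.KbarC * ((𝔇.𝒦 Z t).m * (1 + 2 / κb) ^ 𝔇.ν) * (θ * ((𝔇.𝒦 Z t).m * (1 + 2 / kap'') ^ 𝔇.ν))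
              * (1 + (1 - w.KbarC * ((𝔇.𝒦 Z t).m * (1 + 2 / κb) ^ 𝔇.ν) * (θ * ((𝔇.𝒦 Z t).m * (1 + 2 / kap'') ^ 𝔇.ν)))⁻¹) / 2)
          * (Fintype.card (𝔇.𝒦 Z t).Λ : ℝ)
        + w₂₀ + (2 * (θ * ((𝔇.𝒦 Z t).m * (1 + 2 / kap'') ^ 𝔇.ν)) + (γ₂ + a₂₀)) * cE * (Fintype.card (𝔇.𝒦 Z t).Λ : ℝ)
        + (2 * (θ * ((𝔇.𝒦 Z t).m * (1 + 2 / kap'') ^ 𝔇.ν)) + (γ₂ + a₂₀)) * (1 + 2 * cE * g)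
          * (Fintype.card ((𝔇.𝒦 Z t).Λ ⊕ (𝔇.𝒦 Z t).C₀) : ℝ)
        ≤ a₅ * ((Z.1).card : ℝ))

include hpos hhalf hUτ hUtau hr hr' hsubτ hw hα h𝒦 hu hχ0 hχc0 hχm hχcm hAhol hGhol hAs hA hVm h222 hγ₂ hqP ha0 h220U hfibN hκa hκb h2 h1 hkap''
  hsm hθR1le hsmallKθ hc0 hc hαc hg hΓq hsmall hPa hvol

omit [NormedRing 𝔸] [NormedAlgebra ℂ 𝔸] in
/-- **★ NODE A's WALK RECORD INHABITS W1's RECORD OF LOCATED (2.26) INPUTS AT ONE CONFIGURATION, LETTERS EXHIBITED.**  For a datum at `c⁺`, a term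
`(Z, t)` at `(s, old)` and a configuration `φ` read inside the `α`-ball, the hypotheses of this section give a record `ι : 𝔇.Inputs226Holo c Z t s old φ a a₅`
with `ι.Uσ = ball 0 e^{κ₁+1}` (the (J1) glue), `ι.Uτ = Uτ`, `ι.a₂₀ = a₂₀`, `ι.w = w₂₀`, `ι.κ = κ_b`, `ι.K_G = K̄_Γ`, `ι.K_Cs = K̄_C`,
`ι.θ_Γ = 2K̄_Γ e^{−εR_σ} + 2K̄_Γ α∕R`, `ι.θ_C = K̄_C(2K̄_E e^{−εR_σ} + 2K̄_E α∕R)(m(1+2∕(κ−κ_a)))^ν K̄_C (m(1+2∕(κ_a−κ_b)))^ν`, `ι.θ_E = 2K̄_E e^{−εR_σ} + 2K̄_E α∕R`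
— the seven kernel letters by `localisation17a_of_termWalkData` (dropped to `κ_b`) and `differences216_of_termWalkData` at `u := uOf Z t φ`, the σ-letters
restricted from the closed `c⁺`-polydisc to the open ball, every other field as given.
[cite: Balaban1988RG2Cluster, p.13, (2.14)-(2.16) pp.15-16, (2.18)-(2.26) pp.16-17; Balaban1985BackgroundPropagators, Thm 3.10 p.416] -/
theorem exists_inputs226Holo_of_termWalkData :
    ∃ ι : 𝔇.Inputs226Holo c Z t s old φ a a₅,
      ι.Uσ = ball (0 : ℂ) (Real.exp (c.κ₁ + 1)) ∧ ι.Uτ = Uτ ∧ ι.a₂₀ = a₂₀ ∧ ι.w = w₂₀ ∧ ι.kap = κb ∧ ι.KG = w.KbarΓ ∧ ι.KCs = w.KbarC ∧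
      ι.θΓ = 2 * w.KbarΓ * Real.exp (-(w.ε * w.Rσ)) + 2 * w.KbarΓ * α / w.R ∧
      ι.θC = w.KbarC * (2 * w.KbarE * Real.exp (-(w.ε * w.Rσ)) + 2 * w.KbarE * α / w.R)
          * ((𝔇.𝒦 Z t).m * (1 + 2 / (w.kap - κa)) ^ 𝔇.ν) * w.KbarC * ((𝔇.𝒦 Z t).m * (1 + 2 / (κa - κb)) ^ 𝔇.ν) ∧
      ι.θE = 2 * w.KbarE * Real.exp (-(w.ε * w.Rσ)) + 2 * w.KbarE * α / w.R := by
  -- the (J1) glue: open σ-region of radius `e^{κ₁+1}` between the two closed polydiscs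
  obtain ⟨hUσ, hUexp, hcl⟩ := sigma_region_glue (d := P.d) (N' := domCount P M (k + 1)) c
  have hκb0 : 0 ≤ κb := (hkap''.trans (h1.trans h2)).le
  have hκbw : κb ≤ w.kap := (hκb.trans hκa).le
  have huα : ‖𝔇.uOf Z t φ‖ ≤ α := (mem_ball_zero_iff.1 hu).le
  have huR : 𝔇.uOf Z t φ ∈ ball (0 : 𝔇.E₃) w.R := ball_subset_ball hw.hαR.le hu
  -- L17a at the configuration (dropped to `κb`) and L16a (NODE A's `hAs hA`)
  have h17 : Localisation17a ({ c with κ₁ := c.κ₁ + 1 } : B13.Consts) (fun σ => (𝔇.𝒦 Z t).A2 σ (𝔇.uOf Z t φ))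
      (fun σ => (𝔇.𝒦 Z t).G2 σ (𝔇.uOf Z t φ)) (𝔇.𝒦 Z t).Γ₀ (𝔇.𝒦 Z t).C (𝔇.𝒦 Z t).locΛ (𝔇.𝒦 Z t).locN κb
      w.KbarΓ w.KbarΓ w.KbarC w.KbarC :=
    localisation17a_mono_rate hκbw hw.hKbarΓ hw.hKbarΓ hw.hKbarC hw.hKbarC (localisation17a_of_termWalkData hw hα.le h𝒦 huR)
  have h16 : Differences216 ({ c with κ₁ := c.κ₁ + 1 } : B13.Consts) (fun σ => (𝔇.𝒦 Z t).A2 σ (𝔇.uOf Z t φ))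
      (fun σ => (𝔇.𝒦 Z t).G2 σ (𝔇.uOf Z t φ)) (𝔇.𝒦 Z t).Γ₀ (𝔇.𝒦 Z t).C (𝔇.𝒦 Z t).locΛ (𝔇.𝒦 Z t).locN κb
      (2 * w.KbarΓ * Real.exp (-(w.ε * w.Rσ)) + 2 * w.KbarΓ * α / w.R)
      (w.KbarC * (2 * w.KbarE * Real.exp (-(w.ε * w.Rσ)) + 2 * w.KbarE * α / w.R)
        * ((𝔇.𝒦 Z t).m * (1 + 2 / (w.kap - κa)) ^ 𝔇.ν) * w.KbarC * ((𝔇.𝒦 Z t).m * (1 + 2 / (κa - κb)) ^ 𝔇.ν))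
      (2 * w.KbarE * Real.exp (-(w.ε * w.Rσ)) + 2 * w.KbarE * α / w.R) :=
    differences216_of_termWalkData hw hα.le h𝒦 hκb0 hκb hκa huα hAs hA
  have hθΓ0 : 0 ≤ 2 * w.KbarΓ * Real.exp (-(w.ε * w.Rσ)) + 2 * w.KbarΓ * α / w.R := by
    have := hw.hKbarΓ; have := (hα.trans hw.hαR).le; positivity
  have hθE0 : 0 ≤ 2 * w.KbarE * Real.exp (-(w.ε * w.Rσ)) + 2 * w.KbarE * α / w.R := by
    have := hw.hKbarE; have := (hα.trans hw.hαR).le; positivity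
  have hθC0 : 0 ≤ w.KbarC * (2 * w.KbarE * Real.exp (-(w.ε * w.Rσ)) + 2 * w.KbarE * α / w.R)
      * ((𝔇.𝒦 Z t).m * (1 + 2 / (w.kap - κa)) ^ 𝔇.ν) * w.KbarC * ((𝔇.𝒦 Z t).m * (1 + 2 / (κa - κb)) ^ 𝔇.ν) := by
    have := hw.hKbarC
    have h1' : 0 < w.kap - κa := sub_pos.2 hκa
    have h2' : 0 < κa - κb := sub_pos.2 hκb
    positivity
  have hθEle : 2 * w.KbarE * Real.exp (-(w.ε * w.Rσ)) + 2 * w.KbarE * α / w.R ≤ θ := (Eq.trans_le (by ring) hsm.hE)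
  have hθΓle : 2 * w.KbarΓ * Real.exp (-(w.ε * w.Rσ)) + 2 * w.KbarΓ * α / w.R ≤ θ := (Eq.trans_le (by ring) hsm.hΓ)
  refine ⟨{
      hpos := hpos, hhalf := hhalf, Uσ := ball (0 : ℂ) (Real.exp (c.κ₁ + 1)), Uτ := Uτ, hUσ := hUσ, hUτ := hUτ, hUexp := hUexp
      hUtau := hUtau, hr := hr, hr' := hr', hsubτ := hsubτ, hχ0 := hχ0, hχc0 := hχc0, hAhol := hAhol, hGhol := hGhol, hχm := hχm, hχcm := hχcm
      hVm := hVm, hAs := fun σ hσ => hAs σ (hcl σ hσ), hA := fun σ hσ => hA σ (hcl σ hσ), γ₂ := γ₂, rP := rP, a₂₀ := a₂₀, w := w₂₀, qP := qP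
      h222 := h222, hγ₂ := hγ₂, hqP := hqP, h220U := h220U, ha0 := ha0, hfibN := hfibN, kap := κb, kap' := kap', kap'' := kap'', θ := θ
      θE := 2 * w.KbarE * Real.exp (-(w.ε * w.Rσ)) + 2 * w.KbarE * α / w.R
      θΓ := 2 * w.KbarΓ * Real.exp (-(w.ε * w.Rσ)) + 2 * w.KbarΓ * α / w.R
      θC := w.KbarC * (2 * w.KbarE * Real.exp (-(w.ε * w.Rσ)) + 2 * w.KbarE * α / w.R)
          * ((𝔇.𝒦 Z t).m * (1 + 2 / (w.kap - κa)) ^ 𝔇.ν) * w.KbarC * ((𝔇.𝒦 Z t).m * (1 + 2 / (κa - κb)) ^ 𝔇.ν)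
      KG := w.KbarΓ, KΓ := w.KbarΓ, KCs := w.KbarC, K₀ := w.KbarC, hkap'' := hkap'', h1 := h1, h2 := h2, hθE := hθE0, hθΓ := hθΓ0, hθC := hθC0
      hKG := hw.hKbarΓ, hKΓ := hw.hKbarΓ, hKCs := hw.hKbarC, hK₀ := hw.hKbarC, hθEle := hθEle, hθΓle := hθΓle, hθR1le := hθR1le
      hG := fun σ hσ => h17.hG σ (hcl σ hσ), hΓ₀ := h17.hΓ₀, hCs := fun σ hσ => h17.hCs σ (hcl σ hσ), hC216 := h17.hC216
      hdΓ := fun σ hσ => h16.hdΓ σ (hcl σ hσ), hdC := fun σ hσ => h16.hdC σ (hcl σ hσ), hdE := fun σ hσ => h16.hdE σ (hcl σ hσ)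
      hsmallKθ := hsmallKθ, cE := cE, g := g, hc0 := hc0, hc := hc, hαc := hαc, hg := hg, hΓq := hΓq, hsmall := hsmall, hPa := hPa, hvol := hvol },
    rfl, rfl, rfl, rfl, rfl, rfl, rfl, rfl, rfl, rfl⟩

omit [NormedRing 𝔸] [NormedAlgebra ℂ 𝔸] in
/-- **W1's `PrimitiveInputs226Holo` AT ONE CONFIGURATION FROM NODE A's WALK RECORD** (the Prop shadow of `exists_inputs226Holo_of_termWalkData`; whence
(2.26) at `φ` by `norm_TF_le_weight_of_inputs226Holo`). [cite: Balaban1988RG2Cluster, (2.14)-(2.26) pp.15-17, p.13] -/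
theorem primitiveInputs226Holo_of_termWalkData : 𝔇.PrimitiveInputs226Holo c Z t s old φ a a₅ :=
  let ⟨ι, _⟩ := exists_inputs226Holo_of_termWalkData 𝔇 Z t s old hpos hhalf hUτ hUtau hr hr' hsubτ hw hα h𝒦 hu hχ0 hχc0 hχm hχcm hAhol hGhol hAs hA
    hVm qP h222 hγ₂ hqP ha0 h220U hfibN hκa hκb h2 h1 hkap'' hsm hθR1le hsmallKθ hc0 hc hαc hg hΓq hsmall hPa hvol
  ⟨ι⟩

end Point

/-! ## §2 An open table read into the `α`-ball: file 30's table-based hypothesis, and (T-an) + W1's record on the table -/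

section Table

variable (hκ₁ : 1 ≤ c.κ₁) (hα₆ : c.α₆ ≠ 0)
    (Z : (domSys P M (k + 1)).Dom) (t : TermLabel P M k L) (s : ℂ) (old : OlderTerms P 𝔸 M k) {V : Set (CPair P 𝔸)} (hV : IsOpen V)
    (hpos : ∀ Y : TDom P.d (L * domCount P M (k + 1)), 0 < invTau c ((tsys P.d (L * domCount P M (k + 1))).dj Y))
    (hhalf : ∀ Y : TDom P.d (L * domCount P M (k + 1)), invTau c ((tsys P.d (L * domCount P M (k + 1))).dj Y) ≤ 1 / 2)
    {Uτ : TDom P.d (L * domCount P M (k + 1)) → Set ℂ} (hUτ : ∀ Y, IsOpen (Uτ Y))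
    (hUtau : ∀ Y : TDom P.d (L * domCount P M (k + 1)),
      closedBall (0 : ℂ) ((invTau c ((tsys P.d (L * domCount P M (k + 1))).dj Y))⁻¹) ⊆ Uτ Y)
    (hr : 0 < 𝔇.r) (hr' : 𝔇.r ≤ Real.exp c.κ₁ - 1)
    (hsubτ : ∀ Y, ∀ x ∈ Set.uIcc (0 : ℝ) 1, closedBall (x : ℂ) 𝔇.r ⊆ Uτ Y)
    {w : WalkConsts} {α Rσ₀ : ℝ} (hw : w.Admissible α Rσ₀) (hα : 0 < α)
    (hχ0 : ∀ B, 0 ≤ 𝔇.chiY₀ Z t s B) (hχc0 : ∀ B, 0 ≤ 𝔇.chicP Z t s B)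
    (hχm : Measurable (𝔇.chiY₀ Z t s)) (hχcm : Measurable (𝔇.chicP Z t s))
    (hAhol : ∀ φ ∈ V, ∀ i j, DifferentiableOn ℂ (fun σ => 𝔇.A Z t φ σ i j) {σ | ∀ j, σ j ∈ ball (0 : ℂ) (Real.exp (c.κ₁ + 1))})
    (hGhol : ∀ φ ∈ V, ∀ i j,
      DifferentiableOn ℂ (fun σ => (𝔇.𝒦 Z t).G2 σ (𝔇.uOf Z t φ) i j) {σ | ∀ j, σ j ∈ ball (0 : ℂ) (Real.exp (c.κ₁ + 1))})
    (hAs : ∀ φ ∈ V, ∀ σ : TPt P.d (domCount P M (k + 1)) → ℂ, (∀ j, ‖σ j‖ ≤ Real.exp (c.κ₁ + 1)) → (𝔇.A Z t φ σ).IsSymm)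
    (hA : ∀ φ ∈ V, ∀ σ : TPt P.d (domCount P M (k + 1)) → ℂ, (∀ j, ‖σ j‖ ≤ Real.exp (c.κ₁ + 1)) →
      ((𝔇.A Z t φ σ).map Complex.re).PosDef)
    (hVholφ : ∀ Y B, DifferentiableOn ℂ (fun φ => 𝔇.𝒱 Z t s old φ Y B) V)
    (hVm : ∀ φ ∈ V, ∀ Y, Measurable (𝔇.𝒱 Z t s old φ Y))
    {γ₂ rP a₂₀ w₂₀ : ℝ} (qP : ((𝔇.𝒦 Z t).Λ → ℝ) → ℝ)
    (h222 : ∀ B, 𝔇.chiY₀ Z t s B * 𝔇.chicP Z t s B ≤ Real.exp (-(γ₂ / 2 * rP ^ 2 * (t.2.card : ℕ)) + γ₂ / 2 * qP B)) (hγ₂ : 0 ≤ γ₂)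
    (hqP : ∀ B, qP B ≤ B ⬝ᵥ B) (ha0 : 0 ≤ a₂₀)
    (h220U : ∀ φ ∈ V, ∀ τ : TDom P.d (L * domCount P M (k + 1)) → ℂ, (∀ Y, τ Y ∈ Uτ Y) →
      ∀ B, ∑ Y ∈ t.1, ‖τ Y‖ * ‖𝔇.𝒱 Z t s old φ Y B‖ ≤ a₂₀ / 2 * (B ⬝ᵥ B) + w₂₀)
    (hfibN : ∀ x : UT 𝔇.Nf, (Finset.univ.filter fun j => (𝔇.𝒦 Z t).locN j = x).card ≤ (𝔇.𝒦 Z t).m)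
    {κa κb kap' kap'' θ : ℝ} (hκa : κa < w.kap) (hκb : κb < κa) (h2 : kap' < κb) (h1 : kap'' < kap') (hkap'' : 0 < kap'')
    (hsm : SmallTheta w α θ)
    (hθR1le : ((𝔇.𝒦 Z t).m * (1 + 2 / (κb - kap')) ^ 𝔇.ν) * ((𝔇.𝒦 Z t).m * (1 + 2 / (kap' - kap'')) ^ 𝔇.ν)
      * ((2 * w.KbarΓ * Real.exp (-(w.ε * w.Rσ)) + 2 * w.KbarΓ * α / w.R) * w.KbarC * w.KbarΓ
        + w.KbarΓ * (w.KbarC * (2 * w.KbarE * Real.exp (-(w.ε * w.Rσ)) + 2 * w.KbarE * α / w.R)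
            * ((𝔇.𝒦 Z t).m * (1 + 2 / (w.kap - κa)) ^ 𝔇.ν) * w.KbarC * ((𝔇.𝒦 Z t).m * (1 + 2 / (κa - κb)) ^ 𝔇.ν)) * w.KbarΓ
        + w.KbarΓ * w.KbarC * (2 * w.KbarΓ * Real.exp (-(w.ε * w.Rσ)) + 2 * w.KbarΓ * α / w.R)) ≤ θ)
    (hsmallKθ : w.KbarC * ((𝔇.𝒦 Z t).m * (1 + 2 / κb) ^ 𝔇.ν) * (θ * ((𝔇.𝒦 Z t).m * (1 + 2 / kap'') ^ 𝔇.ν)) < 1)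
    {cE g : ℝ} (hc0 : 0 ≤ cE) (hc : ∀ i, (𝔇.𝒦 Z t).hC.1.eigenvalues i ≤ cE)
    (hαc : (2 * (θ * ((𝔇.𝒦 Z t).m * (1 + 2 / kap'') ^ 𝔇.ν)) + (γ₂ + a₂₀)) * cE ≤ 1 / 2) (hg : 0 ≤ g)
    (hΓq : ∀ X : (𝔇.𝒦 Z t).Λ ⊕ (𝔇.𝒦 Z t).C₀ → ℝ,
      ((𝔇.𝒦 Z t).Γ₀ *ᵥ X) ⬝ᵥ ((𝔇.𝒦 Z t).C *ᵥ ((𝔇.𝒦 Z t).Γ₀ *ᵥ X)) ≤ g * (X ⬝ᵥ X))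
    (hsmall : (2 * (θ * ((𝔇.𝒦 Z t).m * (1 + 2 / kap'') ^ 𝔇.ν)) + (γ₂ + a₂₀)) * (1 + 2 * cE * g) ≤ 1 / 2)
    {a a₅ : ℝ} (hPa : a ≤ γ₂ * rP ^ 2)
    (hvol : 2 * (w.KbarC * ((𝔇.𝒦 Z t).m * (1 + 2 / κb) ^ 𝔇.ν) * (θ * ((𝔇.𝒦 Z t).m * (1 + 2 / kap'') ^ 𝔇.ν))
              * (1 + (1 - w.KbarC * ((𝔇.𝒦 Z t).m * (1 + 2 / κb) ^ 𝔇.ν) * (θ * ((𝔇.𝒦 Z t).m * (1 + 2 / kap'') ^ 𝔇.ν)))⁻¹) / 2)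
          * (Fintype.card (𝔇.𝒦 Z t).Λ : ℝ)
        + w₂₀ + (2 * (θ * ((𝔇.𝒦 Z t).m * (1 + 2 / kap'') ^ 𝔇.ν)) + (γ₂ + a₂₀)) * cE * (Fintype.card (𝔇.𝒦 Z t).Λ : ℝ)
        + (2 * (θ * ((𝔇.𝒦 Z t).m * (1 + 2 / kap'') ^ 𝔇.ν)) + (γ₂ + a₂₀)) * (1 + 2 * cE * g)
          * (Fintype.card ((𝔇.𝒦 Z t).Λ ⊕ (𝔇.𝒦 Z t).C₀) : ℝ)
        ≤ a₅ * ((Z.1).card : ℝ))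

include hpos hhalf hUτ hUtau hr hr' hsubτ hw hα hχ0 hχc0 hχm hχcm hAhol hGhol hAs hA hVholφ hVm h222 hγ₂ hqP ha0 h220U hfibN hκa hκb h2 h1 hkap''
  hsm hθR1le hsmallKθ hc0 hc hαc hg hΓq hsmall hPa hvol

/-- **★★ FILE 30's TABLE-BASED HYPOTHESIS FROM ONE WALK RECORD AND THE READING MAP.**  On an open table `V` whose reading map `uOf Z t` is holomorphic into
the `α`-ball, with §1's inputs at every `φ ∈ V` (same letters everywhere) and LEMMA 2's holomorphy of the potentials IN `φ`: at every `φ₁ ∈ V` the record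
of §1, whose eleven configuration-dependent fields hold on all of `V` (the same projections at every point), together with the three joint-holomorphy letters
for its σ-region `ball 0 e^{κ₁+1}` — holomorphy IN `φ` of `A(σ, uOf φ)`, `G(σ, uOf φ)` by NODE A's joint walk expansions (`JointWalkExpansion.analyticOnBall`,
[B9] Thm 3.10) ∘ the reading map (chain rule), of the potentials by `hVholφ`.
[cite: Balaban1988RG2Cluster, p.13, (2.14)-(2.16) pp.15-16 and the analyticity statement p.15, (2.20)-(2.26) pp.16-17; Balaban1985BackgroundPropagators, Thm 3.10 p.416] -/
theorem inputs226Holo_on_of_termWalkData (h𝒦 : TermWalkData (𝔇.𝒦 Z t) w)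
    (huOf : DifferentiableOn ℂ (𝔇.uOf Z t) V) (hmaps : MapsTo (𝔇.uOf Z t) V (ball (0 : 𝔇.E₃) α)) :
    ∀ φ₁ ∈ V, ∃ ι : 𝔇.Inputs226Holo c Z t s old φ₁ a a₅,
      (∀ φ ∈ V, ∀ i j, DifferentiableOn ℂ (fun σ => 𝔇.A Z t φ σ i j) {σ | ∀ j, σ j ∈ ι.Uσ}) ∧
      (∀ φ ∈ V, ∀ i j, DifferentiableOn ℂ (fun σ => (𝔇.𝒦 Z t).G2 σ (𝔇.uOf Z t φ) i j) {σ | ∀ j, σ j ∈ ι.Uσ}) ∧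
      (∀ σ : TPt P.d (domCount P M (k + 1)) → ℂ, (∀ j, σ j ∈ ι.Uσ) → ∀ i j, DifferentiableOn ℂ (fun φ => 𝔇.A Z t φ σ i j) V) ∧
      (∀ σ : TPt P.d (domCount P M (k + 1)) → ℂ, (∀ j, σ j ∈ ι.Uσ) → ∀ i j, DifferentiableOn ℂ (fun φ => (𝔇.𝒦 Z t).G2 σ (𝔇.uOf Z t φ) i j) V) ∧
      (∀ Y B, DifferentiableOn ℂ (fun φ => 𝔇.𝒱 Z t s old φ Y B) V) ∧
      (∀ φ ∈ V, ∀ Y, Measurable (𝔇.𝒱 Z t s old φ Y)) ∧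
      (∀ φ ∈ V, ∀ σ : TPt P.d (domCount P M (k + 1)) → ℂ, (∀ j, σ j ∈ ι.Uσ) → (𝔇.A Z t φ σ).IsSymm) ∧
      (∀ φ ∈ V, ∀ σ : TPt P.d (domCount P M (k + 1)) → ℂ, (∀ j, σ j ∈ ι.Uσ) → ((𝔇.A Z t φ σ).map Complex.re).PosDef) ∧
      (∀ φ ∈ V, ∀ τ : TDom P.d (L * domCount P M (k + 1)) → ℂ, (∀ Y, τ Y ∈ ι.Uτ Y) →
        ∀ B, ∑ Y ∈ t.1, ‖τ Y‖ * ‖𝔇.𝒱 Z t s old φ Y B‖ ≤ ι.a₂₀ / 2 * (B ⬝ᵥ B) + ι.w) ∧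
      (∀ φ ∈ V, ∀ σ : TPt P.d (domCount P M (k + 1)) → ℂ, (∀ j, σ j ∈ ι.Uσ) →
        ∀ b j, ‖(𝔇.𝒦 Z t).G2 σ (𝔇.uOf Z t φ) b j‖ ≤ ι.KG * Real.exp (-(ι.kap * tdist1 𝔇.Nf ((𝔇.𝒦 Z t).locΛ b) ((𝔇.𝒦 Z t).locN j)))) ∧
      (∀ φ ∈ V, ∀ σ : TPt P.d (domCount P M (k + 1)) → ℂ, (∀ j, σ j ∈ ι.Uσ) →
        ∀ b b', ‖(𝔇.A Z t φ σ)⁻¹ b b'‖ ≤ ι.KCs * Real.exp (-(ι.kap * tdist1 𝔇.Nf ((𝔇.𝒦 Z t).locΛ b) ((𝔇.𝒦 Z t).locΛ b')))) ∧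
      (∀ φ ∈ V, ∀ σ : TPt P.d (domCount P M (k + 1)) → ℂ, (∀ j, σ j ∈ ι.Uσ) →
        ∀ b j, ‖((𝔇.𝒦 Z t).G2 σ (𝔇.uOf Z t φ) - (𝔇.𝒦 Z t).Γ₀.map (algebraMap ℝ ℂ)) b j‖
          ≤ ι.θΓ * Real.exp (-(ι.kap * tdist1 𝔇.Nf ((𝔇.𝒦 Z t).locΛ b) ((𝔇.𝒦 Z t).locN j)))) ∧
      (∀ φ ∈ V, ∀ σ : TPt P.d (domCount P M (k + 1)) → ℂ, (∀ j, σ j ∈ ι.Uσ) →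
        ∀ b b', ‖((𝔇.A Z t φ σ)⁻¹ - (𝔇.𝒦 Z t).C.map (algebraMap ℝ ℂ)) b b'‖
          ≤ ι.θC * Real.exp (-(ι.kap * tdist1 𝔇.Nf ((𝔇.𝒦 Z t).locΛ b) ((𝔇.𝒦 Z t).locΛ b')))) ∧
      (∀ φ ∈ V, ∀ σ : TPt P.d (domCount P M (k + 1)) → ℂ, (∀ j, σ j ∈ ι.Uσ) →
        ∀ b b', ‖(𝔇.A Z t φ σ - (𝔇.𝒦 Z t).C⁻¹.map (algebraMap ℝ ℂ)) b b'‖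
          ≤ ι.θE * Real.exp (-(ι.kap * tdist1 𝔇.Nf ((𝔇.𝒦 Z t).locΛ b) ((𝔇.𝒦 Z t).locΛ b')))) := by
  -- the (J1) glue and the configuration readings of the table
  obtain ⟨-, -, hcl⟩ := sigma_region_glue (d := P.d) (N' := domCount P M (k + 1)) c
  have hκb0 : 0 ≤ κb := (hkap''.trans (h1.trans h2)).le
  have hκbw : κb ≤ w.kap := (hκb.trans hκa).le
  have huα : ∀ φ ∈ V, ‖𝔇.uOf Z t φ‖ ≤ α := fun φ hφ => (mem_ball_zero_iff.1 (hmaps hφ)).le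
  have hmapsR : MapsTo (𝔇.uOf Z t) V (ball (0 : 𝔇.E₃) w.R) := hmaps.mono_right (ball_subset_ball hw.hαR.le)
  -- L17a ∕ L16a at every configuration of the table, same letters
  have h17 : ∀ φ ∈ V, Localisation17a ({ c with κ₁ := c.κ₁ + 1 } : B13.Consts) (fun σ => (𝔇.𝒦 Z t).A2 σ (𝔇.uOf Z t φ))
      (fun σ => (𝔇.𝒦 Z t).G2 σ (𝔇.uOf Z t φ)) (𝔇.𝒦 Z t).Γ₀ (𝔇.𝒦 Z t).C (𝔇.𝒦 Z t).locΛ (𝔇.𝒦 Z t).locN κb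
      w.KbarΓ w.KbarΓ w.KbarC w.KbarC := fun φ hφ =>
    localisation17a_mono_rate hκbw hw.hKbarΓ hw.hKbarΓ hw.hKbarC hw.hKbarC (localisation17a_of_termWalkData hw hα.le h𝒦 (hmapsR hφ))
  have h16 : ∀ φ ∈ V, Differences216 ({ c with κ₁ := c.κ₁ + 1 } : B13.Consts) (fun σ => (𝔇.𝒦 Z t).A2 σ (𝔇.uOf Z t φ))
      (fun σ => (𝔇.𝒦 Z t).G2 σ (𝔇.uOf Z t φ)) (𝔇.𝒦 Z t).Γ₀ (𝔇.𝒦 Z t).C (𝔇.𝒦 Z t).locΛ (𝔇.𝒦 Z t).locN κb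
      (2 * w.KbarΓ * Real.exp (-(w.ε * w.Rσ)) + 2 * w.KbarΓ * α / w.R)
      (w.KbarC * (2 * w.KbarE * Real.exp (-(w.ε * w.Rσ)) + 2 * w.KbarE * α / w.R)
        * ((𝔇.𝒦 Z t).m * (1 + 2 / (w.kap - κa)) ^ 𝔇.ν) * w.KbarC * ((𝔇.𝒦 Z t).m * (1 + 2 / (κa - κb)) ^ 𝔇.ν))
      (2 * w.KbarE * Real.exp (-(w.ε * w.Rσ)) + 2 * w.KbarE * α / w.R) := fun φ hφ =>
    differences216_of_termWalkData hw hα.le h𝒦 hκb0 hκb hκa (huα φ hφ) (hAs φ hφ) (hA φ hφ)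
  -- holomorphy IN THE CONFIGURATION: the joint walk expansions' analyticity in `u` ([B9] Thm 3.10) ∘ the reading map (chain rule)
  obtain ⟨WΓ, TΓ, SXΓ, AΓ, DΓ, ρΓ, hΓw⟩ := h𝒦.hΓ
  obtain ⟨WE, TE, SXE, AE, DE, ρE, hEw⟩ := h𝒦.hE
  have hAholφ : ∀ σ : TPt P.d (domCount P M (k + 1)) → ℂ, (∀ j, σ j ∈ ball (0 : ℂ) (Real.exp (c.κ₁ + 1))) →
      ∀ i j, DifferentiableOn ℂ (fun φ => 𝔇.A Z t φ σ i j) V := fun σ hσ i j =>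
    ((hEw.analyticOnBall hw.hε) σ (hcl σ hσ) i j).comp huOf hmapsR
  have hGholφ : ∀ σ : TPt P.d (domCount P M (k + 1)) → ℂ, (∀ j, σ j ∈ ball (0 : ℂ) (Real.exp (c.κ₁ + 1))) →
      ∀ i j, DifferentiableOn ℂ (fun φ => (𝔇.𝒦 Z t).G2 σ (𝔇.uOf Z t φ) i j) V := fun σ hσ i j =>
    ((hΓw.analyticOnBall hw.hε) σ (hcl σ hσ) i j).comp huOf hmapsR
  intro φ₁ hφ₁
  obtain ⟨ι, hUσ, hUτ', ha₂₀, hw', hkap, hKG, hKCs, hθΓ, hθC, hθE⟩ :=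
    exists_inputs226Holo_of_termWalkData 𝔇 Z t s old hpos hhalf hUτ hUtau hr hr' hsubτ hw hα h𝒦 (hmaps hφ₁) hχ0 hχc0 hχm hχcm (hAhol φ₁ hφ₁)
      (hGhol φ₁ hφ₁) (hAs φ₁ hφ₁) (hA φ₁ hφ₁) (hVm φ₁ hφ₁) qP h222 hγ₂ hqP ha0 (h220U φ₁ hφ₁) hfibN hκa hκb h2 h1 hkap'' hsm hθR1le hsmallKθ
      hc0 hc hαc hg hΓq hsmall hPa hvol
  refine ⟨ι, ?_, ?_, ?_, ?_, hVholφ, hVm, ?_, ?_, ?_, ?_, ?_, ?_, ?_, ?_⟩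
  · rw [hUσ]; exact hAhol
  · rw [hUσ]; exact hGhol
  · rw [hUσ]; exact hAholφ
  · rw [hUσ]; exact hGholφ
  · rw [hUσ]; exact fun φ hφ σ hσ => hAs φ hφ σ (hcl σ hσ)
  · rw [hUσ]; exact fun φ hφ σ hσ => hA φ hφ σ (hcl σ hσ)
  · rw [hUτ', ha₂₀, hw']; exact h220U
  · rw [hUσ, hKG, hkap]; exact fun φ hφ σ hσ => (h17 φ hφ).hG σ (hcl σ hσ)
  · rw [hUσ, hKCs, hkap]; exact fun φ hφ σ hσ => (h17 φ hφ).hCs σ (hcl σ hσ)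
  · rw [hUσ, hθΓ, hkap]; exact fun φ hφ σ hσ => (h16 φ hφ).hdΓ σ (hcl σ hσ)
  · rw [hUσ, hθC, hkap]; exact fun φ hφ σ hσ => (h16 φ hφ).hdC σ (hcl σ hσ)
  · rw [hUσ, hθE, hkap]; exact fun φ hφ σ hσ => (h16 φ hφ).hdE σ (hcl σ hσ)

include hκ₁ hα₆ hV

/-- **★★ (T-an) ON THE TABLE AND W1's RECORD AT EVERY POINT OF THE TABLE, FROM ONE WALK RECORD** — file 30's
`analyticOnNhd_and_primitiveInputs226Holo_of_inputs226Holo_on` fed by `inputs226Holo_on_of_termWalkData`: under this section's inputs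
`φ ↦ 𝔇.TF Z t s old φ` is ANALYTIC at every point of the open table `V` (file 23's (T-an) type per term, [Chae1985] Thm 14.13) AND W1's propositional record
`PrimitiveInputs226Holo c` holds at every `φ ∈ V` (whence (2.26) there — file 25's (T-226) — by `norm_TF_le_weight_of_inputs226Holo`): the configuration
chain of N18 at W1's datum now FACTORS THROUGH STOREY 8's record.
[cite: Balaban1988RG2Cluster, (2.14) p.15 and the analyticity statement p.15, (2.26) p.17, p.13; Balaban1985BackgroundPropagators, Thm 3.10 p.416; Chae1985, Thm 14.13] -/
theorem analyticOnNhd_and_primitiveInputs226Holo_of_termWalkData (h𝒦 : TermWalkData (𝔇.𝒦 Z t) w)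
    (huOf : DifferentiableOn ℂ (𝔇.uOf Z t) V) (hmaps : MapsTo (𝔇.uOf Z t) V (ball (0 : 𝔇.E₃) α)) :
    AnalyticOnNhd ℂ (fun φ => 𝔇.TF Z t s old φ) V ∧ ∀ φ ∈ V, 𝔇.PrimitiveInputs226Holo c Z t s old φ a a₅ :=
  analyticOnNhd_and_primitiveInputs226Holo_of_inputs226Holo_on 𝔇 hκ₁ hα₆ Z t s old hV
    (inputs226Holo_on_of_termWalkData 𝔇 Z t s old hpos hhalf hUτ hUtau hr hr' hsubτ hw hα hχ0 hχc0 hχm hχcm hAhol hGhol hAs hA hVholφ hVm qP h222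
      hγ₂ hqP ha0 h220U hfibN hκa hκb h2 h1 hkap'' hsm hθR1le hsmallKθ hc0 hc hαc hg hΓq hsmall hPa hvol h𝒦 huOf hmaps)

end Table

end Summit.QuantumFields.YangMills.BalabanUVNodes.N18HLayerW1TermWalkRecordInputs226

end
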